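import Summits.QuantumFields.YangMills.Theorems.BalabanUVNodesN09SectGCompositionBookkeeping
import Summits.QuantumFields.YangMills.Theorems.BalabanUVNodesN09B0RiderAtRecord

/-!
# NODE N09 — (L2′) THE DOOR's ROW `hmemχ` «FIELDS IN THE SUPPORT OF χ^{(2.9)}_{i+1} OVER MEMBERSHIP DATA ARE MEMBERSHIP DATA» INHABITED MODULO NAMED ROWS, ON THE WINDOW-PROPORTIONAL ROAD:
# [B11] Sect. G in the Lipschitz form (`SectGLipschitzMinimiser`, (L1c)) ∘ N07's Theorem-1 rows (`hres`∕`huniq` at the datum, the slot at the field) ∘ the p. 266–267 rider (a theorem) ∘ NUMERICS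

Cell `pub-ymgap` (YM-PLAN Track A), seat `pub-ymgap-dag-n09-w1` g8; helper of K1⁹ `StabilityBRunRowsAtRecordR13SepCoPHV` = stmt-QuantumFields-27364 (`--supports`, count-neutral).
Director-ym №320 (4) OPTION (L): «type [B11] Sect. G ∕ Prop. 9 as the INHABITANT of `hmemχ`» — (L1a) ✓p750055 `SectGLocalisedMinimiser` (the (173) print image), (L1b) ✓p750238 bookkeeping,
(L3) ✓p750448 `hopen`, (L1c) `SectGLipschitzMinimiser` (the window-proportional form, appended to the (L1a) file — the shape dag-ref-H READ-604 (iii) ∕ DEF-1 ∕ RR-2 WORD-26 asked for after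
ref-H's PRE-LANDING FLAG on the (173)-road); THIS FILE = (L2′), the composition on the (L1c) road.  [I] = [Balaban1987RG1], [B7] = [Balaban1985Averaging], [B11] = [Balaban1985Variational].

THE ROW (door v1.3, `…N09MembershipSupportClauseReading.hχregU_of_suppPt_of_memχ` ✓p748582, at `dom := domUOfRecord θ₀.ν εbg ρ P.K`):
  `hmemχ : ∀ i, i+1 < K → ∀ U, Ū ∈ domU_{i+2} → χ^{(2.9)}_{i+1}(U) ≠ 0 → UkExists (i+1) εbg U ∧ UniqueUkOrbit (i+1) εbg U ∧ Uk (i+1) εbg U ∈ bgReg (i+1) ρ`.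
PRINT ([I] p. 265): «we assume that W is so regular that the minimal configurations U_{k+1}(W) exist and belong to the space 𝔘_{k+1}(ε₀) … We will define the characteristic function χ_k in
such a way that the domain of integration in (2.1) is restricted to configurations V for which U_k(V) ∈ 𝔘_k(ε₀) … As in Sect. G [15] we write U_k(V′V^{(k)}) = U′_k(V′)U_{k+1} … We obtain
U′_k u_k⁻¹ = exp iηH_k(B′), where the 𝔤-valued configuration H_k(B′) is regular and of the same order as B′.»

THE COMPOSITION (§2, one level; §3, the door's family form) — TWO LETTERS (DEF-1 l.31072 (3)): the base point's (7)-size `ε₁` and the fluctuation window `δ`.  For `U` at level `i+1` with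
`W := Ū ∈ domU^ρ_{i+2}` and `χ^{(2.9)}_{i+1}(U) = 1`:
(1) `V₀ := V^{(i+1)}(W) = M^{i+1}(U_{i+2}(W))` ((2.3); K0e `critCfgOfRecord`, at `ν.εreg = εbg` — the pin `hεbg`, `rfl` at the Z3 instance where both letters are `a₀`); by N07's rows AT THE
    DATUM `W` (`hres`: «U_{i+2}(W) restricts to level i+1», `huniq`: the minimal orbit over `V₀` is unique — the door's own rows, ✓p747700) the level-`(i+1)` problem at `V₀` is solvable-unique
    and its minimiser of record is a residual transform of `U_{i+2}(W) ∈ bgReg (i+2) ρ = bgReg (i+1) (ρ∕L²)` (`bgReg_succ_eq_div_Lsq` ✓p750238) — the `L⁻²` ROOM; `V₀` is `2ρ∕L²`-small ([B7] Prop. 2,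
    `plaqSmall_iter_Uk_of_mem_bgReg` ✓p746936), hence `ε₁`-small for `2ρ∕L² ≤ ε₁` (the base letter).
(2) `V′ := U·V₀⁻¹` bondwise has `dist1 (V′ b) = fluctDevOfRecord … U b` (K0e): `< ε₂₉ ≤ δ` off the distinguished bonds ((2.9) = `χ = 1`), and `≤ ε′ := 10·((d+2)L·ε₂₉)·L^{d−1} < δ` AT them —
    the p. 266–267 RIDER, a THEOREM at the record (dag-n09-w4 g3 `…N09B0RiderAtRecord.hb0_of_hsolν_of_numerics`, here in the POINTWISE-solvability form §1 this door needs: solvability of `W`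
    only, which membership supplies).  So `V′` is `δ`-small at EVERY bond, `δ ≤ C₁ε₁` (inside (172)'s ball).
(3) `U = V′·V₀` is `(ε₁ + 4δ)`-small (plaquette triangle inequality, K0e's `dist1_plaqHol_le_add`∕`plaqDev_le_four_mul`), so N07's Theorem-1 SLOT AT THE FIELD (`hslot`: existence and uniqueness
    at `εbg` on `PlaqSmall (ε₁ + 4δ)` at level `i+1`, [B11] Thm 1 (6), (9) in the window `B₃(ε₁ + 4δ) ≤ εbg ≤ a₀`; displayed, N07's) gives the first two conjuncts.
(4) [B11] Sect. G in the window-proportional form (`hG : SectGLipschitzMinimiser F N B₃ B₆ C₁ a₀ a₁ κ`, the NAMED FACT — a hypothesis; this file is CONDITIONAL on it by name) localises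
    `Uk (i+1) εbg U` in `bgReg (i+1) (ρ∕L² + κB₆δ) ⊆ bgReg (i+1) ρ` under the ROOM row `ρ∕L² + κB₆δ ≤ ρ` — the third conjunct.  The rows `2ρ∕L² ≤ ε₁`, `δ ≤ C₁ε₁`, ROOM are jointly
    inhabitable for EVERY positive letter assignment (`δ ≤ min (C₁ε₁) (ρ(1 − L⁻²)∕(κB₆))`, cf. `room_of_small_fluctuation` ✓p750238): an UPPER bound on the (2.9) window only — CHECK (D) untouched.

WHAT IS PROVED (0 def, 0 sorry; THEOREMS only; nothing of Bałaban asserted):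
* §1 ★ `hb0_at_of_ukExists_of_numerics` — the rider with POINTWISE solvability of the datum (generalises `…N09B0RiderAtRecord.hb0_of_hsolν_of_numerics` :65, whose `hsolν` is global on
  `domAlt`; strictly weaker hypothesis, same proof adapted — not a restatement).
* §2 ★★★ `memRows_at_of_sectG` — ONE LEVEL: the three conjuncts of `hmemχ` at `U` from `hG` + the pin `ν.εreg = εbg` + N07's rows at `W` (`hresW`, `huniqW`) and at `U` (`hslot`) + numerics.
* §3 ★★★ `hmemχ_onDomU_of_sectG` — THE DOOR's ROW `hmemχ` VERBATIM (at `dom := domUOfRecord θ₀.ν εbg ρ P.K`, `g := gOfRecord₁₃ θ₀ P`) from `hG`, the pin, the door's OWN rows `hres`∕`huniq`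
  (binders of ✓p747700 verbatim), the slot family `hslot`, and numerics.  With ✓p750448 ((L3) `hopen`) the door's displayed analytic rows are now ALL inhabited modulo: the named fact `hG`,
  N07's [B11] Thm 1 rows (`hres`, `huniq`, `hslot`, (L3)'s `hint`∕`huniqIn`), K0e's pointwise (F7a) `hχregpt`, `hind` ((D1′)), and NUMERICS (no empty row: (4)).
* §4 ★ `sectG_window_iff` — THE RECORD OF WHY THE (173)-ROAD IS NOT TAKEN (ref-H READ-604, from the kernel side): for `0 < ρ`, `0 ≤ κB₅`, the rows `2ρ∕L² ≤ ε₁` ∧ `ρ∕L² + κB₅ε₁ ≤ ρ` of a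
  composition over §1's COMMON-letter fact are jointly inhabitable IFF `1 + 2κB₅ ≤ L²` — empty at print's `B₅ = 6B₁B₃C₁`, `B₃ ≳ L²`.  ★ `sectGLocalised_of_lipschitz` — the bridge: the
  window-proportional fact at `δ := C₁ε₁` IS the (173)-form with `B₅ := B₆C₁` (so (L1a) is a COROLLARY shape of (L1c), `0 ≤ C₁`).
* §5 ★ `twoLetterWindow_inhabited` (appended) — NON-VACUITY of §2–§3's window rows in (`ε₁`, `δ`): at any `ρ > 0` with `2(1+4C₁)ρ ≤ a₁L²`, `2B₃(1+4C₁)ρ ≤ εbg L²` the witnesses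
  `ε₁ := 2ρ∕L²`, `δ := min (C₁ε₁) (ρ∕(2(κB₆+1)))` meet every row not naming `ε₂₉`; the `ε₂₉`-rows are upper bounds by the positive `δ` (no floor).

HONEST FRAMING.  Count-neutral composition BY NAME: CONDITIONAL on `SectGLipschitzMinimiser` (asserted by nobody; GAP-STATED (γ1)–(γ3), (γ5) in its file) and on N07's displayed [B11]
Thm 1 rows; the rider and all bookkeeping are tree theorems; NO K-text touched (K0⁸∕K1⁹∕K3⁹ byte-identical; V23∕V24 floors untouched); FLAG №7′ stays OPEN until the director rules on the (L)
residue — this file makes `hmemχ`'s inhabitant «[B11] Sect. G (Lipschitz form) named fact + N07 rows + numerics (window-proportional room)»; N09 ∕ N07 ∕ N24 NOT discharged; COUNT 8∕28 ·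
K-count 1∕4 UNMOVED; one finite four-torus per run at `ε = L^{−K}` (R4 = the conditional rung `BalabanLadder.UV` only); NOT continuum ∕ ℝ⁴ ∕ OS; the Yang–Mills mass gap (Clay) is NOT proved.
-/
noncomputable section

namespace Summit.QuantumFields.YangMills.BalabanUVNodes.N09MembershipSupportOfSectG

open MeasureTheory Set
open Literature.MathematicalPhysics.QuantumFieldTheory.Balaban1983to89
open Literature.MathematicalPhysics.QuantumFieldTheory.Balaban1983to89.T4Continuum (T4Family)
open Literature.MathematicalPhysics.QuantumFieldTheory.Balaban1983to89.Node00
open Literature.MathematicalPhysics.QuantumFieldTheory.Balaban1983to89.ExpMeanLog (deltaSU expMeanLogSU)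
open Literature.MathematicalPhysics.QuantumFieldTheory.Balaban1983to89.BlockAveraging (Idx loopHol avgFun)
open Literature.MathematicalPhysics.QuantumFieldTheory.Balaban1983to89.B12SmallFieldDomain259 (b0)
open Literature.MathematicalPhysics.QuantumFieldTheory.Balaban1983to89.B12B0RestrictionNonlinear267 (norm_pertVar_b0_le_pow dist1_inv_mul_eq_norm_pertVar)
open Literature.MathematicalPhysics.QuantumFieldTheory.Balaban1983to89.B11SectGPerturbedComposition (SectGLocalisedMinimiser SectGLipschitzMinimiser)
open T4TiltOscillation (bdev)
open T4ExpWindowSmallField (plaqDev plaqDev_le_four_mul dist1_plaqHol_le_add)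
open Summit.QuantumFields.YangMills.BalabanUVNodes.N09NestingOfHierAxial (hcrit_of_ukExists pow_mul_eta_le_inv)
open Summit.QuantumFields.YangMills.BalabanUVNodes.N09BackgroundRadiiTransfer (mem_bgReg_iff_of_orbitRel bgReg_mono)
open Summit.QuantumFields.YangMills.BalabanUVNodes.N09MembershipNestingKernel (plaqSmall_iter_Uk_of_mem_bgReg)
open Summit.QuantumFields.YangMills.BalabanUVNodes.N09MembershipDomainDoorAtRecord (numerics_ρ_of_le)
open Summit.QuantumFields.YangMills.BalabanUVNodes.N09SectGCompositionBookkeeping (bgReg_succ_eq_div_Lsq room_of_small_fluctuation)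
open scoped Matrix.Norms.L2Operator

variable {F : T4Family} {N : ℕ} [NeZero N]

/-! ## §1. The p. 266–267 rider with POINTWISE solvability of the datum -/

/-- ★ **THE p. 266–267 RIDER, POINTWISE IN THE DATUM**: for `j < K`, a step-`j` field `U` whose average `Ū` is solvable at `ν.εreg` at level `j+1` (THIS datum only — membership supplies it;
`…N09B0RiderAtRecord.hb0_of_hsolν_of_numerics` asks it on all of `domAlt_{j+1}`) and `χ^{(2.9)}_j(U) = 1`, every distinguished variable satisfies
`fluctDevOfRecord ν K j U (b₀ c) ≤ 10·((d+2)L·ε₂₉)·L^{d−1}` — the NONLINEAR rider for the (0.4) averaging (`B12B0RestrictionNonlinear267.norm_pertVar_b0_le_pow`) at `V := V^{(j)}(Ū)`, the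
[B7] Prop-2 smallness of `V^{(j)}(Ū)` (`hcrit_of_ukExists`) and numerics.  Proof adapted from dag-n09-w4 g3's (same lines, `hsol` for `hsolν j hj W havg`).
[cite: Balaban1987RG1, (2.9) p.266 and p.267; Balaban1985Averaging, Prop. 2 (53) p.26] -/
theorem hb0_at_of_ukExists_of_numerics (θ₀ : Stage13Params F N) {K : ℕ} (g : ℕ → ℝ) (hεreg : 0 < θ₀.ν.εreg)
    (hε3 : (143 * (((((F.P K).d + 4 : ℕ) : ℝ)) ^ 2 / 4) ^ 2) * θ₀.ν.εreg ≤ 1 / 3)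
    (hε2 : 2 * θ₀.ν.εreg ≤ 2 * deltaSU (Fin N) / ((((F.P K).d + 4) * (F.P K).L : ℕ) : ℝ) ^ 2) (hε29 : 0 ≤ θ₀.ε₂₉)
    (hn1 : 1640 * (2 * (((((F.P K).d + 2) * (F.P K).L : ℕ) : ℝ) * θ₀.ε₂₉) +
        ((((F.P K).d + 2) * (F.P K).L : ℕ) : ℝ) ^ 2 / 4 * (2 * θ₀.ν.εreg / ((F.P K).L : ℝ) ^ 2)) * (((F.P K).L : ℝ) ^ ((F.P K).d - 1)) ^ 2 ≤ 1)
    (hn2 : 13 * (2 * (((((F.P K).d + 2) * (F.P K).L : ℕ) : ℝ) * θ₀.ε₂₉) +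
        ((((F.P K).d + 2) * (F.P K).L : ℕ) : ℝ) ^ 2 / 4 * (2 * θ₀.ν.εreg / ((F.P K).L : ℝ) ^ 2)) * ((F.P K).L : ℝ) ^ ((F.P K).d - 1) < deltaSU (Fin N))
    {j : ℕ} (hj : j < K) {U : GaugeField (F.P K) j (SU N)} (hsol : UkExists F N K (j + 1) θ₀.ν.εreg ((avOfRecord F N K j).avg U))
    (hχ : chiβOfRecord₁₃ F N θ₀ K g j U = 1) {b : PBond (F.P K) j} (hb : IsB0 b) :
    fluctDevOfRecord F N θ₀.ν K j U b ≤ 10 * (((((F.P K).d + 2) * (F.P K).L : ℕ) : ℝ) * θ₀.ε₂₉) * ((F.P K).L : ℝ) ^ ((F.P K).d - 1) := by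
  -- adapted from Summits/…/BalabanUVNodesN09B0RiderAtRecord.hb0_of_hsolν_of_numerics (pointwise solvability)
  obtain ⟨c, rfl⟩ := hb
  have hjr : j + 1 ≤ (F.P K).m + (F.P K).K := by rw [T4Family.P_m, T4Family.P_K]; have := F.hm; omega
  have hd : 2 ≤ (F.P K).d := by rw [T4Family.P_d]; norm_num
  set W := (avOfRecord F N K j).avg U with hW
  set V := critCfgOfRecord F N θ₀.ν K j W with hV
  have hM : avgFun (expMeanLogSU (n := Fin N)) U c = avgFun (expMeanLogSU (n := Fin N)) V c := by
    have h1 : (avOfRecord F N K j).avg V = W := avg_critCfgOfRecord hsol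
    have h2 : (avOfRecord F N K j).avg U = W := rfl
    rw [avOfRecord_avg] at h1 h2
    exact (congrFun h2 c).trans (congrFun h1 c).symm
  have hχ' : chiFix29OfRecord F N θ₀.ν θ₀.ε₂₉ K j U = 1 := hχ
  have hF : ∀ b : PBond (F.P K) j, (∀ c' : PBond (F.P K) (j + 1), b ≠ b0 c') →
      ‖BlockAveragingEMLLinearisedBackground.pertVar V U b‖ ≤ θ₀.ε₂₉ := by
    intro b hb
    have h := (chiFix29OfRecord_eq_one_iff θ₀.ν θ₀.ε₂₉ K j U).1 hχ' b (fun ⟨c', hc'⟩ => hb c' hc'.symm)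
    rw [fluctDevOfRecord_apply, ← hW, ← hV, dist1_inv_mul_eq_norm_pertVar] at h
    exact h.le
  have hL0 : (0 : ℝ) < (F.P K).L := by exact_mod_cast (F.P K).L_pos
  have hcrit : PlaqSmall (2 * θ₀.ν.εreg / ((F.P K).L : ℝ) ^ 2) V :=
    hcrit_of_ukExists θ₀.ν hεreg hε3 hε2 (by rw [div_mul_cancel₀ _ (by positivity)]) hsol
  have ha : 0 ≤ 2 * θ₀.ν.εreg / ((F.P K).L : ℝ) ^ 2 := by positivity
  have hloops : ∀ i, dist1 (loopHol V c i) ≤ ((((F.P K).d + 2) * (F.P K).L : ℕ) : ℝ) ^ 2 / 4 * (2 * θ₀.ν.εreg / ((F.P K).L : ℝ) ^ 2) :=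
    fun i => BlockAveragingEMLProp2.dist1_loopHol_le' ha (fun q => (hcrit q).le) c i
  have h := norm_pertVar_b0_le_pow hjr hd U V c hε29 hM hF hloops hn1 hn2
  rw [fluctDevOfRecord_apply, ← hW, ← hV, dist1_inv_mul_eq_norm_pertVar]
  exact h

/-! ## §2. One level: the three conjuncts of `hmemχ` at a field `U` in the support of `χ^{(2.9)}_{i+1}` over a membership datum -/

/-- ★★★ **(L2′) AT ONE LEVEL — `hmemχ`'s CONJUNCTS AT `U` FROM [B11] SECT. G (LIPSCHITZ FORM) + N07's ROWS + THE RIDER + NUMERICS.**  Level `i+1` (`i+1 < K`), `U` with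
`W := Ū ∈ domU^ρ_{i+2}` (membership at `εbg`, radius `ρ`) and `χ^{(2.9)}_{i+1}(U) ≠ 0`.  HYPOTHESES: the named fact `hG : SectGLipschitzMinimiser F N B₃ B₆ C₁ a₀ a₁ κ` ([I] p. 265 «H_k(B′) of
the same order as B′» over [B11] (172)–(174), Prop. 9; asserted by nobody); the pin `hεbg : ν.εreg = εbg` (the critical configuration of record is read at `ν.εreg`; `rfl` at the Z3 instance);
the rider's numerics (`hεreg`, `hε3`, `hε2`, `hε29`, `hn1`, `hn2` — dag-n09-w4 g3's letters); `0 < ρ ≤ ν.εreg`; the TWO-LETTER window: base `0 < ε₁` with `2ρ∕L² ≤ ε₁`, fluctuation `δ` with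
`ε₂₉ ≤ δ`, `ε′ < δ`, `δ ≤ C₁ε₁`; Thm 1's window at the field `ε₁ + 4δ ≤ a₁`, `B₃(ε₁ + 4δ) ≤ εbg ≤ a₀` (`0 ≤ B₃`); the ROOM `ρ∕L² + κB₆δ ≤ ρ`; N07's rows AT THE DATUM (`hresW`: (0.23)
restriction of `U_{i+2}(W)` to level `i+1`; `huniqW`: uniqueness over `V^{(i+1)}(W)`) and AT THE FIELD (`hslot`: existence and uniqueness at `εbg` on `PlaqSmall (ε₁ + 4δ)`, [B11] Thm 1 (6), (9)).
CONCLUSION: `UkExists (i+1) εbg U ∧ UniqueUkOrbit (i+1) εbg U ∧ Uk (i+1) εbg U ∈ bgReg (i+1) ρ`.  Steps (1)–(4) of the module docstring.  CONDITIONAL; nothing of Bałaban asserted.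
[cite: Balaban1987RG1, (2.1)–(2.3) p.265, (2.9) p.266 and p.267, (1.2) p.260; Balaban1985Variational, Thm 1 (6)–(9) p.279, (172)–(174) p.305 and Prop. 9 p.309; Balaban1985Averaging, Prop. 2 (53) p.26] -/
theorem memRows_at_of_sectG (θ₀ : Stage13Params F N) {K : ℕ} (g : ℕ → ℝ) {εbg ρ B₃ B₆ C₁ a₀ a₁ κ ε₁ δ : ℝ}
    (hG : SectGLipschitzMinimiser F N B₃ B₆ C₁ a₀ a₁ κ) (hεbg : θ₀.ν.εreg = εbg)
    (hεreg : 0 < θ₀.ν.εreg)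
    (hε3 : (143 * (((((F.P K).d + 4 : ℕ) : ℝ)) ^ 2 / 4) ^ 2) * θ₀.ν.εreg ≤ 1 / 3)
    (hε2 : 2 * θ₀.ν.εreg ≤ 2 * deltaSU (Fin N) / ((((F.P K).d + 4) * (F.P K).L : ℕ) : ℝ) ^ 2) (hε29 : 0 ≤ θ₀.ε₂₉)
    (hn1 : 1640 * (2 * (((((F.P K).d + 2) * (F.P K).L : ℕ) : ℝ) * θ₀.ε₂₉) +
        ((((F.P K).d + 2) * (F.P K).L : ℕ) : ℝ) ^ 2 / 4 * (2 * θ₀.ν.εreg / ((F.P K).L : ℝ) ^ 2)) * (((F.P K).L : ℝ) ^ ((F.P K).d - 1)) ^ 2 ≤ 1)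
    (hn2 : 13 * (2 * (((((F.P K).d + 2) * (F.P K).L : ℕ) : ℝ) * θ₀.ε₂₉) +
        ((((F.P K).d + 2) * (F.P K).L : ℕ) : ℝ) ^ 2 / 4 * (2 * θ₀.ν.εreg / ((F.P K).L : ℝ) ^ 2)) * ((F.P K).L : ℝ) ^ ((F.P K).d - 1) < deltaSU (Fin N))
    (hρ : 0 < ρ) (hρreg : ρ ≤ θ₀.ν.εreg)
    (hB₃ : 0 ≤ B₃) (h₁ : 0 < ε₁) (hρε : 2 * ρ / ((F.P K).L : ℝ) ^ 2 ≤ ε₁) (h29 : θ₀.ε₂₉ ≤ δ)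
    (hb0δ : 10 * (((((F.P K).d + 2) * (F.P K).L : ℕ) : ℝ) * θ₀.ε₂₉) * ((F.P K).L : ℝ) ^ ((F.P K).d - 1) < δ) (hδ : δ ≤ C₁ * ε₁)
    (h₂ : ε₁ + 4 * δ ≤ a₁) (h₃ : B₃ * (ε₁ + 4 * δ) ≤ εbg) (h₄ : εbg ≤ a₀)
    (hroom : ρ / ((F.P K).L : ℝ) ^ 2 + κ * B₆ * δ ≤ ρ)
    {i : ℕ} (hi : i + 1 < K) {U : GaugeField (F.P K) (i + 1) (SU N)}
    (hW : (avOfRecord F N K (i + 1)).avg U ∈ domUOfRecord F N θ₀.ν εbg ρ K (i + 2))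
    (hne : chiβOfRecord₁₃ F N θ₀ K g (i + 1) U ≠ 0)
    (hresW : IsBackground (avOfRecord F N K) (bgReg F N K (i + 1) εbg) (i + 1)
      (Averaging.iter (avOfRecord F N K) (i + 1) (Uk F N K (i + 2) εbg ((avOfRecord F N K (i + 1)).avg U)))
      (Uk F N K (i + 2) εbg ((avOfRecord F N K (i + 1)).avg U)))
    (huniqW : UniqueUkOrbit F N K (i + 1) εbg
      (Averaging.iter (avOfRecord F N K) (i + 1) (Uk F N K (i + 2) εbg ((avOfRecord F N K (i + 1)).avg U))))
    (hslot : ∀ V : GaugeField (F.P K) (i + 1) (SU N), PlaqSmall (ε₁ + 4 * δ) V →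
      UkExists F N K (i + 1) εbg V ∧ UniqueUkOrbit F N K (i + 1) εbg V) :
    UkExists F N K (i + 1) εbg U ∧ UniqueUkOrbit F N K (i + 1) εbg U ∧ Uk F N K (i + 1) εbg U ∈ bgReg F N K (i + 1) ρ := by
  subst hεbg
  have hδ0 : 0 ≤ δ := hε29.trans h29
  have hL0 : (0 : ℝ) < (F.P K).L := by exact_mod_cast (F.P K).L_pos
  obtain ⟨hρ3, hρ2⟩ := numerics_ρ_of_le (F := F) (N := N) (K := K) hρreg hε3 hε2
  set W := (avOfRecord F N K (i + 1)).avg U with hWdef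
  obtain ⟨-, hexW, -, hmemW⟩ := (mem_domUOfRecord_iff θ₀.ν θ₀.ν.εreg ρ K (i + 2) W).1 hW
  -- (1) the critical configuration over `W` and its level-(i+1) data
  set V₀ : GaugeField (F.P K) (i + 1) (SU N) := Averaging.iter (avOfRecord F N K) (i + 1) (Uk F N K (i + 2) θ₀.ν.εreg W) with hV₀def
  have hcc : critCfgOfRecord F N θ₀.ν K (i + 1) W = V₀ := by rw [hV₀def]; rfl
  have hex₀ : UkExists F N K (i + 1) θ₀.ν.εreg V₀ := ⟨_, hresW⟩
  have hun₀ : UniqueUkOrbit F N K (i + 1) θ₀.ν.εreg V₀ := huniqW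
  have hrel : B12GaugeOrbits021.OrbitRel (i + 1) (Uk F N K (i + 2) θ₀.ν.εreg W) (Uk F N K (i + 1) θ₀.ν.εreg V₀) :=
    hun₀ _ _ hresW (isBackground_Uk hex₀)
  have hmemW' : Uk F N K (i + 2) θ₀.ν.εreg W ∈ bgReg F N K (i + 1) (ρ / ((F.P K).L : ℝ) ^ 2) := by
    rw [← bgReg_succ_eq_div_Lsq]; exact hmemW
  have hcomp₀ : Uk F N K (i + 1) θ₀.ν.εreg V₀ ∈ bgReg F N K (i + 1) (ρ / ((F.P K).L : ℝ) ^ 2) :=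
    (mem_bgReg_iff_of_orbitRel hrel).1 hmemW'
  have hV₀small : PlaqSmall ε₁ V₀ := by
    have h := plaqSmall_iter_Uk_of_mem_bgReg hρ hρ3 hρ2 hmemW (j := i + 1) (by omega)
    have hη0 : 0 ≤ ((F.P K).L : ℝ) ^ (i + 1) * (F.P K).eta (i + 2) := by unfold Params.eta; positivity
    have hsq : (((F.P K).L : ℝ) ^ (i + 1) * (F.P K).eta (i + 2)) ^ 2 ≤ (((F.P K).L : ℝ)⁻¹) ^ 2 :=
      pow_le_pow_left₀ hη0 (pow_mul_eta_le_inv (by omega)) 2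
    have hbound : 2 * ρ * (((F.P K).L : ℝ) ^ (i + 1) * (F.P K).eta (i + 2)) ^ 2 ≤ ε₁ := by
      calc 2 * ρ * (((F.P K).L : ℝ) ^ (i + 1) * (F.P K).eta (i + 2)) ^ 2 ≤ 2 * ρ * (((F.P K).L : ℝ)⁻¹) ^ 2 := by gcongr
        _ = 2 * ρ / ((F.P K).L : ℝ) ^ 2 := by rw [inv_pow, div_eq_mul_inv]
        _ ≤ ε₁ := hρε
    exact fun p => (h p).trans_le hbound
  -- (2) the fluctuation `V′ := U·V₀⁻¹` is `δ`-small at EVERY bond: (2.9) off the distinguished bonds, the rider at them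
  have hχ1 : chiβOfRecord₁₃ F N θ₀ K g (i + 1) U = 1 := by
    rcases chiFix29OfRecord_eq_zero_or_one θ₀.ν θ₀.ε₂₉ K (i + 1) U with h | h
    · exact absurd h hne
    · exact h
  have hfl : ∀ b : PBond (F.P K) (i + 1), fluctDevOfRecord F N θ₀.ν K (i + 1) U b < δ := by
    intro b
    by_cases hb : IsB0 b
    · exact (hb0_at_of_ukExists_of_numerics θ₀ g hεreg hε3 hε2 hε29 hn1 hn2 hi hexW hχ1 hb).trans_lt hb0δ
    · have hχ' : chiFix29OfRecord F N θ₀.ν θ₀.ε₂₉ K (i + 1) U = 1 := hχ1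
      exact ((chiFix29OfRecord_eq_one_iff θ₀.ν θ₀.ε₂₉ K (i + 1) U).1 hχ' b hb).trans_le h29
  set V' : GaugeField (F.P K) (i + 1) (SU N) := fun b => U b * (V₀ b)⁻¹ with hV'def
  have hprod : (fun b => V' b * V₀ b) = U := funext fun b => inv_mul_cancel_right (U b) (V₀ b)
  have hV' : ∀ b : PBond (F.P K) (i + 1), dist1 (V' b) < δ := by
    intro b
    have h := hfl b
    rw [fluctDevOfRecord_eq_dist1_mul_inv, hcc] at h
    exact h
  have hbd : ∀ b : PBond (F.P K) (i + 1), dist1 (bdev U V₀ b) ≤ δ := by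
    intro b
    have h := hfl b
    rw [fluctDevOfRecord_apply, hcc] at h
    exact h.le
  -- (3) `U` is `(ε₁ + 4δ)`-small, so N07's slot gives existence and uniqueness at `U`
  have hUsmall : PlaqSmall (ε₁ + 4 * δ) U := by
    intro p
    calc dist1 (GaugeField.plaqHol U p) ≤ dist1 (GaugeField.plaqHol V₀ p) + plaqDev U V₀ p := dist1_plaqHol_le_add U V₀ p
      _ < ε₁ + 4 * δ := add_lt_add_of_lt_of_le (hV₀small p) (plaqDev_le_four_mul hbd p)
  obtain ⟨hexU, hunU⟩ := hslot U hUsmall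
  -- (4) [B11] Sect. G (window-proportional form) localises the minimiser of `U = V′·V₀` in `bgReg (i+1) (ρ∕L² + κB₆δ) ⊆ bgReg (i+1) ρ`
  have h14 : ε₁ ≤ ε₁ + 4 * δ := by linarith
  have h₂' : ε₁ ≤ a₁ := h14.trans h₂
  have h₃' : B₃ * ε₁ ≤ θ₀.ν.εreg := (mul_le_mul_of_nonneg_left h14 hB₃).trans h₃
  have hex' : UkExists F N K (i + 1) θ₀.ν.εreg (fun b => V' b * V₀ b) := by rw [hprod]; exact hexU
  have hun' : UniqueUkOrbit F N K (i + 1) θ₀.ν.εreg (fun b => V' b * V₀ b) := by rw [hprod]; exact hunU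
  have hloc := hG K (i + 1) ε₁ θ₀.ν.εreg (ρ / ((F.P K).L : ℝ) ^ 2) δ V₀ V' h₁ h₂' h₃' h₄ hV₀small hex₀ hun₀ hcomp₀ hδ0 hδ hV' hex' hun'
  rw [hprod] at hloc
  exact ⟨hexU, hunU, bgReg_mono hroom hloc⟩

/-! ## §3. The door's row `hmemχ` at `domUOfRecord θ₀.ν εbg ρ P.K`, verbatim, from the door's own `hres`∕`huniq`, the slot family, the named fact and numerics -/

/-- ★★★ **(L2′) — THE DOOR's ROW `hmemχ` INHABITED MODULO NAMED ROWS, WINDOW-PROPORTIONAL ROAD.**  At the membership family `domU := domUOfRecord θ₀.ν εbg ρ P.K` and the record's coupling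
`g := gOfRecord₁₃ θ₀ P`, the row `hmemχ` of `…N09MembershipSupportClauseReading.hχregU_of_suppPt_of_memχ` (✓p748582) — VERBATIM its binder — follows from: the [B11] Sect. G named fact in the
Lipschitz form `hG : SectGLipschitzMinimiser F N B₃ B₆ C₁ a₀ a₁ κ` (asserted by nobody), the pin `ν.εreg = εbg` (`rfl` at the Z3 instance: both `a₀`), the door's OWN displayed rows `hres`,
`huniq` (the binders of ✓p747700 `hCompT_onDomU` verbatim — N07's [B11] Thm 1 (0.23)∕(9) species), the Theorem-1 slot family `hslot` at every level (existence and uniqueness at `εbg` on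
`PlaqSmall (ε₁ + 4δ)` — N07's, [B11] Thm 1 (6), (9); displayed), the rider's numerics (dag-n09-w4 g3's letters), and the TWO-LETTER window (base `ε₁ ≥ 2ρ∕L²`; fluctuation `δ ∈ [ε₂₉ ∨ ε′, C₁ε₁]`;
ROOM `ρ∕L² + κB₆δ ≤ ρ` — inhabitable for every positive letter assignment).  HOW A CONSUMER USES IT: feed this term as `hmemχ` to `hχregU_of_suppPt_of_memχ θ₀ P (hdom_domUOfRecord θ₀.ν εbg ρ P.K)
hχregpt ·`, whose output is the door's `hχregU` (✓p747700 `hCompT_onDomU` ∕ `indA_onDomU` ∕ `thm3Member_onDomU_of_hind`).  CONDITIONAL on `hG` and the displayed rows; nothing of Bałaban asserted;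
FLAG №7′ not closed by this file (director's ruling).
[cite: Balaban1987RG1, p.265, (2.9) p.266 and p.267, (1.1)–(1.2) p.260; Balaban1985Variational, Thm 1 (6)–(9) p.279, (172)–(174) p.305 and Prop. 9 p.309; Balaban1985Averaging, Prop. 2 (53) p.26] -/
theorem hmemχ_onDomU_of_sectG (θ₀ : Stage13Params F N) (P : B12.RunParams) {εbg ρ B₃ B₆ C₁ a₀ a₁ κ ε₁ δ : ℝ}
    (hG : SectGLipschitzMinimiser F N B₃ B₆ C₁ a₀ a₁ κ) (hεbg : θ₀.ν.εreg = εbg)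
    (hεreg : 0 < θ₀.ν.εreg)
    (hε3 : (143 * (((((F.P P.K).d + 4 : ℕ) : ℝ)) ^ 2 / 4) ^ 2) * θ₀.ν.εreg ≤ 1 / 3)
    (hε2 : 2 * θ₀.ν.εreg ≤ 2 * deltaSU (Fin N) / ((((F.P P.K).d + 4) * (F.P P.K).L : ℕ) : ℝ) ^ 2) (hε29 : 0 ≤ θ₀.ε₂₉)
    (hn1 : 1640 * (2 * (((((F.P P.K).d + 2) * (F.P P.K).L : ℕ) : ℝ) * θ₀.ε₂₉) +
        ((((F.P P.K).d + 2) * (F.P P.K).L : ℕ) : ℝ) ^ 2 / 4 * (2 * θ₀.ν.εreg / ((F.P P.K).L : ℝ) ^ 2)) * (((F.P P.K).L : ℝ) ^ ((F.P P.K).d - 1)) ^ 2 ≤ 1)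
    (hn2 : 13 * (2 * (((((F.P P.K).d + 2) * (F.P P.K).L : ℕ) : ℝ) * θ₀.ε₂₉) +
        ((((F.P P.K).d + 2) * (F.P P.K).L : ℕ) : ℝ) ^ 2 / 4 * (2 * θ₀.ν.εreg / ((F.P P.K).L : ℝ) ^ 2)) * ((F.P P.K).L : ℝ) ^ ((F.P P.K).d - 1) < deltaSU (Fin N))
    (hρ : 0 < ρ) (hρreg : ρ ≤ θ₀.ν.εreg)
    (hB₃ : 0 ≤ B₃) (h₁ : 0 < ε₁) (hρε : 2 * ρ / ((F.P P.K).L : ℝ) ^ 2 ≤ ε₁) (h29 : θ₀.ε₂₉ ≤ δ)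
    (hb0δ : 10 * (((((F.P P.K).d + 2) * (F.P P.K).L : ℕ) : ℝ) * θ₀.ε₂₉) * ((F.P P.K).L : ℝ) ^ ((F.P P.K).d - 1) < δ) (hδ : δ ≤ C₁ * ε₁)
    (h₂ : ε₁ + 4 * δ ≤ a₁) (h₃ : B₃ * (ε₁ + 4 * δ) ≤ εbg) (h₄ : εbg ≤ a₀)
    (hroom : ρ / ((F.P P.K).L : ℝ) ^ 2 + κ * B₆ * δ ≤ ρ)
    (hres : ∀ k, k ≤ P.K → HRestrict F N εbg P.K k (domUOfRecord F N θ₀.ν εbg ρ P.K k))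
    (huniq : ∀ k, k ≤ P.K → ∀ V ∈ domUOfRecord F N θ₀.ν εbg ρ P.K k, ∀ j < k,
      UniqueUkOrbit F N P.K (j + 1) εbg (Averaging.iter (avOfRecord F N P.K) (j + 1) (Uk F N P.K k εbg V)))
    (hslot : ∀ j < P.K, ∀ V : GaugeField (F.P P.K) j (SU N), PlaqSmall (ε₁ + 4 * δ) V →
      UkExists F N P.K j εbg V ∧ UniqueUkOrbit F N P.K j εbg V) :
    ∀ i, i + 1 < P.K → ∀ U : GaugeField (F.P P.K) (i + 1) (SU N),
      (avOfRecord F N P.K (i + 1)).avg U ∈ domUOfRecord F N θ₀.ν εbg ρ P.K (i + 2) →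
        chiβOfRecord₁₃ F N θ₀ P.K (gOfRecord₁₃ F N θ₀ P) (i + 1) U ≠ 0 →
          UkExists F N P.K (i + 1) εbg U ∧ UniqueUkOrbit F N P.K (i + 1) εbg U ∧ Uk F N P.K (i + 1) εbg U ∈ bgReg F N P.K (i + 1) ρ := by
  intro i hi U hW hne
  have hK : i + 2 ≤ P.K := by omega
  exact memRows_at_of_sectG θ₀ (gOfRecord₁₃ F N θ₀ P) hG hεbg hεreg hε3 hε2 hε29 hn1 hn2 hρ hρreg hB₃ h₁ hρε h29 hb0δ hδ h₂ h₃ h₄ hroom hi hW hne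
    (hres (i + 2) hK _ hW i (by omega)) (huniq (i + 2) hK _ hW i (by omega)) (hslot (i + 1) hi)

/-! ## §4. Why the (173)-road is not taken (the window number), and the bridge between the two named facts -/

/-- ★ **THE (173)-ROAD WINDOW — A NUMBER** (ref-H READ-604's pre-landing flag, from the kernel side): for `0 < ρ` and `0 ≤ c` (`c = κB₅`), the two rows a composition over the
COMMON-letter fact `SectGLocalisedMinimiser` would need — `2ρ∕L² ≤ ε₁` (the critical configuration over a `ρ`-member is only `2ρ∕L²`-small, [B7] Prop. 2) and the ROOM `ρ∕L² + cε₁ ≤ ρ` — are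
jointly satisfiable by some `ε₁` IFF `1 + 2c ≤ L²`; at print's `B₅ = 6B₁B₃C₁` ((173)) with `B₃ ≳ L²` this is EMPTY — whence the window-proportional road of §2–§3.  Pure arithmetic.
[cite: Balaban1985Variational, (173) p.305; Balaban1985Averaging, Prop. 2 (53) p.26 (bookkeeping)] -/
theorem sectG_window_iff {ρ L c : ℝ} (hρ : 0 < ρ) (hL : 0 < L) (hc : 0 ≤ c) :
    (∃ ε₁ : ℝ, 2 * ρ / L ^ 2 ≤ ε₁ ∧ ρ / L ^ 2 + c * ε₁ ≤ ρ) ↔ 1 + 2 * c ≤ L ^ 2 := by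
  have hL2 : 0 < L ^ 2 := by positivity
  constructor
  · rintro ⟨ε₁, h1, h2⟩
    have h3 : ρ / L ^ 2 + c * (2 * ρ / L ^ 2) ≤ ρ := by linarith [mul_le_mul_of_nonneg_left h1 hc]
    have h4 : ρ * (1 + 2 * c) / L ^ 2 ≤ ρ := by
      have : ρ * (1 + 2 * c) / L ^ 2 = ρ / L ^ 2 + c * (2 * ρ / L ^ 2) := by ring
      rw [this]; exact h3
    rw [div_le_iff₀ hL2] at h4
    nlinarith
  · intro h
    refine ⟨2 * ρ / L ^ 2, le_rfl, ?_⟩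
    have h4 : ρ * (1 + 2 * c) / L ^ 2 ≤ ρ := by
      rw [div_le_iff₀ hL2]; nlinarith
    have : ρ * (1 + 2 * c) / L ^ 2 = ρ / L ^ 2 + c * (2 * ρ / L ^ 2) := by ring
    linarith [this ▸ h4]

/-- ★ **THE BRIDGE**: the window-proportional fact at `δ := C₁ε₁` IS the (173)-form with `B₅ := B₆C₁` (`0 ≤ C₁`) — (L1a)'s shape is a corollary shape of (L1c)'s; neither is asserted.
[cite: Balaban1985Variational, (172)–(173) p.305 and Prop. 9 p.309 (bookkeeping)] -/
theorem sectGLocalised_of_lipschitz {B₃ B₆ C₁ a₀ a₁ κ : ℝ} (hC₁ : 0 ≤ C₁) (h : SectGLipschitzMinimiser F N B₃ B₆ C₁ a₀ a₁ κ) :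
    SectGLocalisedMinimiser F N B₃ (B₆ * C₁) C₁ a₀ a₁ κ := by
  intro K k ε₁ ε₀ r₀ V₀ V' h₁ h₂ h₃ h₄ h₅ h₆ h₇ h₈ h₉ h₁₀ h₁₁
  have hmain := h K k ε₁ ε₀ r₀ (C₁ * ε₁) V₀ V' h₁ h₂ h₃ h₄ h₅ h₆ h₇ h₈ (mul_nonneg hC₁ h₁.le) le_rfl h₉ h₁₀ h₁₁
  have he : r₀ + κ * B₆ * (C₁ * ε₁) = r₀ + κ * (B₆ * C₁) * ε₁ := by ring
  rw [he] at hmain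
  exact hmain

/-! ## §5. The two-letter window is inhabited (non-vacuity of §2–§3's numerics rows in `ε₁`, `δ` at any door-local radius `ρ` small against `a₁L²`, `εbg L²`) -/

/-- ★ **THE TWO-LETTER WINDOW IS INHABITED** (A6-type certificate for §2–§3; numbers, not adjectives): for every door-local radius `ρ > 0` with `2(1+4C₁)ρ ≤ a₁L²` and
`2B₃(1+4C₁)ρ ≤ εbg·L²` (`0 ≤ B₃`, `0 < C₁`, `0 ≤ c` — `c = κB₆`), the witnesses `ε₁ := 2ρ∕L²`, `δ := min (C₁ε₁) (ρ∕(2(c+1)))` satisfy ALL the window rows of `memRows_at_of_sectG` that do not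
name `ε₂₉`: `0 < ε₁`, `0 < δ`, `2ρ∕L² ≤ ε₁`, `δ ≤ C₁ε₁`, `ε₁ + 4δ ≤ a₁`, `B₃(ε₁ + 4δ) ≤ εbg`, and the ROOM `ρ∕L² + cδ ≤ ρ` (`room_of_small_fluctuation` ✓p750238); the two remaining rows
`ε₂₉ ≤ δ`, `10((d+2)L·ε₂₉)L^{d−1} < δ` are then UPPER bounds on the (2.9) window `ε₂₉` by a positive number — no floor (CHECK (D) species).  Contrast §4: the (173)-road's rows have NO such
witnesses unless `1 + 2κB₅ ≤ L²`.  Pure arithmetic. [cite: Balaban1987RG1, (2.9) p.266 («ε₁ sufficiently small»); Balaban1985Variational, Thm 1 p.279 and (172) p.305 (bookkeeping)] -/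
theorem twoLetterWindow_inhabited {K : ℕ} {ρ c C₁ a₁ εbg B₃ : ℝ} (hρ : 0 < ρ) (hc : 0 ≤ c) (hC₁ : 0 < C₁) (hB₃ : 0 ≤ B₃)
    (hρa : 2 * (1 + 4 * C₁) * ρ ≤ a₁ * ((F.P K).L : ℝ) ^ 2) (hρb : 2 * B₃ * (1 + 4 * C₁) * ρ ≤ εbg * ((F.P K).L : ℝ) ^ 2) :
    ∃ ε₁ δ : ℝ, 0 < ε₁ ∧ 0 < δ ∧ 2 * ρ / ((F.P K).L : ℝ) ^ 2 ≤ ε₁ ∧ δ ≤ C₁ * ε₁ ∧ ε₁ + 4 * δ ≤ a₁ ∧ B₃ * (ε₁ + 4 * δ) ≤ εbg ∧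
      ρ / ((F.P K).L : ℝ) ^ 2 + c * δ ≤ ρ := by
  have hL0 : (0 : ℝ) < (F.P K).L := by exact_mod_cast (F.P K).L_pos
  have hL2 : (0 : ℝ) < ((F.P K).L : ℝ) ^ 2 := by positivity
  set ε₁ : ℝ := 2 * ρ / ((F.P K).L : ℝ) ^ 2 with hε₁
  have hε₁0 : 0 < ε₁ := by positivity
  have hε₁L : ε₁ * ((F.P K).L : ℝ) ^ 2 = 2 * ρ := by rw [hε₁, div_mul_cancel₀ _ hL2.ne']
  refine ⟨ε₁, min (C₁ * ε₁) (ρ / (2 * (c + 1))), hε₁0, lt_min (mul_pos hC₁ hε₁0) (by positivity), le_rfl, min_le_left _ _, ?_, ?_,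
    room_of_small_fluctuation hρ hc (min_le_right _ _)⟩
  · have hδ := min_le_left (C₁ * ε₁) (ρ / (2 * (c + 1)))
    have h1 : (1 + 4 * C₁) * ε₁ ≤ a₁ := by
      refine le_of_mul_le_mul_right ?_ hL2
      calc (1 + 4 * C₁) * ε₁ * ((F.P K).L : ℝ) ^ 2 = (1 + 4 * C₁) * (ε₁ * ((F.P K).L : ℝ) ^ 2) := by ring
        _ = 2 * (1 + 4 * C₁) * ρ := by rw [hε₁L]; ring
        _ ≤ a₁ * ((F.P K).L : ℝ) ^ 2 := hρa
    linarith [hδ, h1]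
  · have hδ := min_le_left (C₁ * ε₁) (ρ / (2 * (c + 1)))
    have h1 : B₃ * ((1 + 4 * C₁) * ε₁) ≤ εbg := by
      refine le_of_mul_le_mul_right ?_ hL2
      calc B₃ * ((1 + 4 * C₁) * ε₁) * ((F.P K).L : ℝ) ^ 2 = B₃ * (1 + 4 * C₁) * (ε₁ * ((F.P K).L : ℝ) ^ 2) := by ring
        _ = 2 * B₃ * (1 + 4 * C₁) * ρ := by rw [hε₁L]; ring
        _ ≤ εbg * ((F.P K).L : ℝ) ^ 2 := hρb
    have h2 : B₃ * (ε₁ + 4 * min (C₁ * ε₁) (ρ / (2 * (c + 1)))) ≤ B₃ * ((1 + 4 * C₁) * ε₁) :=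
      mul_le_mul_of_nonneg_left (by linarith [hδ]) hB₃
    exact h2.trans h1

end Summit.QuantumFields.YangMills.BalabanUVNodes.N09MembershipSupportOfSectG

end
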